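import Summits.QuantumFields.YangMills.Theorems.UnitScaleTiltHalvingStepOfPillarsCERows
import Literature.MathematicalPhysics.QuantumLattice.SmoothingLocalityProofs
import HarnessLib

/-!
# Route `UnitScaleTilt`, crux K1 child «MinimiserStabilityRegPr» (stmt-QuantumFields-19200), registered stub `stub_halvingStep` (v10 `BirthV10`) —
# **LEAD-H RULING L-11 v2 (ρ-WINDOW): FOUR ARITHMETIC BRICKS FOR THE ρ-LINEAR SIZE CONSTANT** — the linear (163) `exists_rho_163_lin` (exponential decay in the
# inner radius `ρ` beats a package constant growing linearly in `ρ`), the package constant against its ρ-linear majorant `package_const_le`, and the C_E «far» ∕ `e₁`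
# bounds against the growth-exposed constants `r_le_growth` ∕ `e₁_bound_growth`

Cell `ym3-torus` (HUMAN RULING D-0037, YM ladder rung R3 — YM₃ on T³ is a RUNG, NOT the Clay problem), width seat `ym-ust-19200-w5` gen 5 (LEAD-H g5).
`--supports stmt-QuantumFields-19200 --as helper`; count-neutral; def-free, 0 sorry, standard axioms; pure real arithmetic — nothing here claims the stub, the crux,
the rung or the gap.  Consumers: ✓`HalvingSitePackage.ceRows_of_chart_stat_growth_room` (C_E rows growth-exposed) and ✓`HalvingStubOfHP1RoomRho2` (the H door with
`B₁ ↦ B₁·(ρ+1)`), see the LOCATE `LOCATE-RHO-WINDOW-w5g5.md` v2 (19200 evidence).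

References: T. Bałaban, CMP **102** (1985) 277–309 [Balaban1985Variational] (163) p.303, (150)–(165) pp.301–303.
-/

set_option autoImplicit false

noncomputable section

namespace Summit.QuantumFields.YangMills.Theorems.HalvingRhoLinearBricks

open HalvingSitePackage (r_le_of_delta_le_one e₁_bound)

/-! ## §1 The linear (163) and the package constant -/

/-- **(163) WITH A ρ-LINEAR PACKAGE CONSTANT**: for `δ₀ > 0` and `T₀, T₁ ≥ 0` there is an integer `ρ ≥ 2` with `(T₀ + T₁(ρ+1))·e^{−δ₀(ρ−2)∕2} ≤ ½` — the twin of
✓`HalvingAssembly.exists_rho_163` (constant `T`) needed once the P1♭ size constant, hence the C_E «far» constant `C₂`, is read ρ-linearly (RULING L-11 v2).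
Proof: `e^{−y} ≤ 2∕y²` (`y²∕2 ≤ e^y`, Mathlib `Real.pow_div_factorial_le_exp`) at `y = δ₀(ρ−2)∕2` with `ρ − 2 ≥ max 3 (32(T₀ + 3T₁ + 1)∕δ₀²)`. [cite: Balaban1985Variational, (163) p.303] -/
theorem exists_rho_163_lin {δ₀ T₀ T₁ : ℝ} (hδ₀ : 0 < δ₀) (hT₀ : 0 ≤ T₀) (hT₁ : 0 ≤ T₁) :
    ∃ ρ : ℕ, (2 : ℝ) ≤ (ρ : ℝ) ∧ (T₀ + T₁ * ((ρ : ℝ) + 1)) * Real.exp (-(δ₀ / 2 * ((ρ : ℝ) - 2))) ≤ 1 / 2 := by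
  set X : ℝ := max 3 (32 * (T₀ + 4 * T₁ + 1) / δ₀ ^ 2) with hX
  have hX3 : (3 : ℝ) ≤ X := le_max_left _ _
  have hX32 : 32 * (T₀ + 4 * T₁ + 1) / δ₀ ^ 2 ≤ X := le_max_right _ _
  have hX0 : 0 < X := by linarith
  refine ⟨⌈2 + X⌉₊, ?_, ?_⟩
  · have h := Nat.le_ceil (2 + X)
    linarith
  · set ρ : ℕ := ⌈2 + X⌉₊ with hρ
    have hge : 2 + X ≤ (ρ : ℝ) := Nat.le_ceil _
    -- `y := δ₀(ρ−2)/2 ≥ δ₀X/2 > 0`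
    set y : ℝ := δ₀ / 2 * ((ρ : ℝ) - 2) with hy
    have hyX : δ₀ / 2 * X ≤ y := by rw [hy]; exact mul_le_mul_of_nonneg_left (by linarith) (by linarith)
    have hy0 : 0 < y := lt_of_lt_of_le (by positivity) hyX
    -- `e^{-y} ≤ 2 / y²`
    have hexp : Real.exp (-y) ≤ 2 / y ^ 2 := by
      have h := Real.pow_div_factorial_le_exp y hy0.le 2
      have h2 : (Nat.factorial 2 : ℝ) = 2 := by norm_num [Nat.factorial]
      rw [h2] at h
      rw [Real.exp_neg, inv_eq_one_div, div_le_div_iff₀ (Real.exp_pos y) (by positivity)]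
      nlinarith [h, Real.exp_pos y]
    -- the linear factor against `2/y²`
    have hρX : (ρ : ℝ) - 2 ≤ X + 1 := by
      have h := Nat.ceil_lt_add_one (show (0 : ℝ) ≤ 2 + X by linarith)
      rw [← hρ] at h
      linarith
    have hlin : T₀ + T₁ * ((ρ : ℝ) + 1) ≤ (T₀ + 4 * T₁ + 1) + T₁ * X := by nlinarith [hρX, hT₁]
    have hy2 : (δ₀ / 2 * X) ^ 2 ≤ y ^ 2 := pow_le_pow_left₀ (by positivity) hyX 2
    have hδX : δ₀ ^ 2 * X ≥ 32 * (T₀ + 4 * T₁ + 1) := by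
      have := (div_le_iff₀ (by positivity : (0 : ℝ) < δ₀ ^ 2)).1 hX32
      linarith
    have hA : 0 ≤ T₀ + T₁ * ((ρ : ℝ) + 1) := by
      have : (0 : ℝ) ≤ (ρ : ℝ) + 1 := by positivity
      positivity
    calc (T₀ + T₁ * ((ρ : ℝ) + 1)) * Real.exp (-(δ₀ / 2 * ((ρ : ℝ) - 2)))
        ≤ ((T₀ + 4 * T₁ + 1) + T₁ * X) * (2 / y ^ 2) := by
          rw [← hy]; exact mul_le_mul hlin hexp (Real.exp_pos _).le (by positivity)
      _ ≤ ((T₀ + 4 * T₁ + 1) + T₁ * X) * (2 / (δ₀ / 2 * X) ^ 2) := by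
          apply mul_le_mul_of_nonneg_left _ (by positivity)
          exact div_le_div_of_nonneg_left (by norm_num) (by positivity) hy2
      _ = 8 * (T₀ + 4 * T₁ + 1) / (δ₀ ^ 2 * X) / X + 8 * T₁ / (δ₀ ^ 2 * X) := by
          field_simp
          ring
      _ ≤ 1 / 4 / X + 1 / 4 := by
          have h1 : 8 * (T₀ + 4 * T₁ + 1) / (δ₀ ^ 2 * X) ≤ 1 / 4 := by
            rw [div_le_iff₀ (by positivity)]; linarith
          have h2 : 8 * T₁ / (δ₀ ^ 2 * X) ≤ 1 / 4 := by
            rw [div_le_iff₀ (by positivity)]; nlinarith [hδX, hT₀, hT₁]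
          have h3 : 8 * (T₀ + 4 * T₁ + 1) / (δ₀ ^ 2 * X) / X ≤ 1 / 4 / X := div_le_div_of_nonneg_right h1 hX0.le
          linarith
      _ ≤ 1 / 2 := by
          have : 1 / 4 / X ≤ 1 / 4 / 3 := div_le_div_of_nonneg_left (by norm_num) (by norm_num) hX3
          linarith

/-- The package constant against its ρ-linear majorant: `4·max(max 12 (c₂(B₁r + 1)), 2∕(B₀B₃))·B₀B₃ ≤ (4B₀B₃(12 + c₂) + 8) + 4B₀B₃·c₂B₁·r` (`r ≥ 1`). [folklore] -/
theorem package_const_le {B₀ B₃ c₂ B₁ r : ℝ} (hBB : 0 < B₀ * B₃) (hc₂ : 0 ≤ c₂) (hB₁ : 0 ≤ B₁) (hr : 1 ≤ r) :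
    4 * max (max 12 (c₂ * (B₁ * r + 1))) (2 / (B₀ * B₃)) * B₀ * B₃ ≤
      (4 * (B₀ * B₃) * (12 + c₂) + 8) + 4 * (B₀ * B₃) * (c₂ * B₁) * r := by
  have h2 : 0 ≤ 2 / (B₀ * B₃) := by positivity
  have hc : 0 ≤ c₂ * (B₁ * r + 1) := by
    have : 0 ≤ B₁ * r := mul_nonneg hB₁ (by linarith)
    positivity
  have hmax : max (max 12 (c₂ * (B₁ * r + 1))) (2 / (B₀ * B₃)) ≤ 12 + c₂ * (B₁ * r + 1) + 2 / (B₀ * B₃) :=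
    max_le (max_le (by linarith) (by linarith)) (by linarith)
  have h8 : 2 / (B₀ * B₃) * (B₀ * B₃) = 2 := div_mul_cancel₀ 2 hBB.ne'
  have hkey : 4 * (12 + c₂ * (B₁ * r + 1) + 2 / (B₀ * B₃)) * B₀ * B₃ =
      (4 * (B₀ * B₃) * (12 + c₂) + 8) + 4 * (B₀ * B₃) * (c₂ * B₁) * r := by
    linear_combination (4 : ℝ) * h8
  calc 4 * max (max 12 (c₂ * (B₁ * r + 1))) (2 / (B₀ * B₃)) * B₀ * B₃
      ≤ 4 * (12 + c₂ * (B₁ * r + 1) + 2 / (B₀ * B₃)) * B₀ * B₃ := by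
        have hB : 0 ≤ B₀ * B₃ := hBB.le
        nlinarith [hmax, hB]
    _ = _ := hkey

/-! ## §2 The C_E «far» and `e₁` bounds against the growth-exposed constants -/

/-- The «far» size `L·r`, `r = δ + B_H q δ²`, `δ = B₁ε₀ ≤ 1`, against the ρ-readable constant `L(1 + B_H C₂♭)(B₁ + 1)ε₀`. [folklore] -/
theorem r_le_growth {Lr BH q C2 B₁ ε₀ : ℝ} (hL : 0 ≤ Lr) (hBH : 0 ≤ BH) (hq : 0 ≤ q) (hqC : q ≤ C2) (hB₁ : 0 ≤ B₁) (hε₀ : 0 ≤ ε₀)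
    (hδ1 : B₁ * ε₀ ≤ 1) : Lr * (B₁ * ε₀ + BH * (q * (B₁ * ε₀) ^ 2)) ≤ Lr * (1 + BH * C2) * (B₁ + 1) * ε₀ := by
  have h := mul_le_mul_of_nonneg_left (r_le_of_delta_le_one hBH hq hqC hB₁ hε₀ hδ1) hL
  have h0 : 0 ≤ Lr * (1 + BH * C2) * ε₀ := by
    have : 0 ≤ 1 + BH * C2 := by nlinarith
    positivity
  nlinarith

/-- ✓`e₁_bound` against the ρ-readable constant `max B₀ʳ (1+B_M)·(4C₄(1 + B_H C₂♭)²)·(B₁+1)²·ε₀²`. [folklore] -/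
theorem e₁_bound_growth {B₀r BM BH C C₄ q C2 B₁ ε₀ : ℝ} (hB₀r : 0 ≤ B₀r) (hBH : 0 ≤ BH) (hC : 0 ≤ C) (hCC : C ≤ C₄)
    (hq : 0 ≤ q) (hqC : q ≤ C2) (hB₁ : 0 ≤ B₁) (hε₀ : 0 ≤ ε₀) (hδ1 : B₁ * ε₀ ≤ 1) :
    max B₀r (1 + BM) * (4 * C * (B₁ * ε₀ + BH * (q * (B₁ * ε₀) ^ 2)) ^ 2) ≤
      max B₀r (1 + BM) * (4 * C₄ * (1 + BH * C2) ^ 2) * (B₁ + 1) ^ 2 * ε₀ ^ 2 := by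
  refine (e₁_bound hB₀r hBH hC hCC hq hqC hB₁ hε₀ hδ1).trans ?_
  have hm : 0 ≤ max B₀r (1 + BM) := le_max_of_le_left hB₀r
  have hC₄ : 0 ≤ C₄ := hC.trans hCC
  have hsq : B₁ ^ 2 ≤ (B₁ + 1) ^ 2 := by nlinarith
  have h0 : 0 ≤ max B₀r (1 + BM) * (4 * C₄ * (1 + BH * C2) ^ 2) := by positivity
  calc max B₀r (1 + BM) * (4 * C₄ * ((1 + BH * C2) * B₁) ^ 2) * ε₀ ^ 2
      = max B₀r (1 + BM) * (4 * C₄ * (1 + BH * C2) ^ 2) * B₁ ^ 2 * ε₀ ^ 2 := by ring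
    _ ≤ max B₀r (1 + BM) * (4 * C₄ * (1 + BH * C2) ^ 2) * (B₁ + 1) ^ 2 * ε₀ ^ 2 :=
        mul_le_mul_of_nonneg_right (mul_le_mul_of_nonneg_left hsq h0) (pow_nonneg hε₀ 2)

/-! ## §3 (v1.1, append-only; LEAD-H L-11 v3) The POLYNOMIAL (163): exponential decay beats any power of the inner radius -/

/-- **(163) WITH A PACKAGE CONSTANT OF POLYNOMIAL GROWTH `T₀ + T₁(ρ+1)^q` IN THE INNER RADIUS**: for `δ₀ > 0`, `T₀, T₁ ≥ 0` and any exponent `q` there is an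
integer `ρ ≥ 2` with `(T₀ + T₁(ρ+1)^q)·e^{−δ₀(ρ−2)∕2} ≤ ½` — the twin of `exists_rho_163_lin` needed once the P1♭ size constant is read as `B₁·(ρ+1)^{q}` with a
supplier-chosen exponent (LEAD-H RULING L-11 v3).  Proof: `e^{−y} ≤ (q+2)!∕y^{q+2}` (lit ✓`QuantumLattice.exp_neg_le_factorial_div_pow`) at `y = δ₀(ρ−2)∕2`, `(ρ+1)^q ≤ 2^q(ρ−2)^q` for `ρ − 2 ≥ 3`, so the product is
`≤ K∕(ρ−2)²` with `K := (T₀ + T₁·2^q)·(q+2)!·(2∕δ₀)^{q+2}`, and `ρ − 2 ≥ max 3 (2K + 1)` suffices. [cite: Balaban1985Variational, (163) p.303] -/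
theorem exists_rho_163_pow {δ₀ T₀ T₁ : ℝ} (hδ₀ : 0 < δ₀) (hT₀ : 0 ≤ T₀) (hT₁ : 0 ≤ T₁) (q : ℕ) :
    ∃ ρ : ℕ, (2 : ℝ) ≤ (ρ : ℝ) ∧ (T₀ + T₁ * ((ρ : ℝ) + 1) ^ q) * Real.exp (-(δ₀ / 2 * ((ρ : ℝ) - 2))) ≤ 1 / 2 := by
  set n : ℕ := q + 2 with hn
  set K : ℝ := (T₀ + T₁ * 2 ^ q) * (Nat.factorial n : ℝ) * (2 / δ₀) ^ n with hK
  have hK0 : 0 ≤ K := by positivity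
  set X : ℝ := max 3 (2 * K + 1) with hX
  have hX3 : (3 : ℝ) ≤ X := le_max_left _ _
  have hXK : 2 * K + 1 ≤ X := le_max_right _ _
  have hX0 : 0 < X := by linarith
  refine ⟨⌈2 + X⌉₊, ?_, ?_⟩
  · have h := Nat.le_ceil (2 + X)
    linarith
  · set ρ : ℕ := ⌈2 + X⌉₊ with hρ
    have hge : 2 + X ≤ (ρ : ℝ) := Nat.le_ceil _
    set z : ℝ := (ρ : ℝ) - 2 with hz
    have hzX : X ≤ z := by rw [hz]; linarith
    have hz3 : 3 ≤ z := hX3.trans hzX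
    have hz0 : 0 < z := by linarith
    set y : ℝ := δ₀ / 2 * z with hy
    have hy0 : 0 < y := by positivity
    -- `e^{-y} ≤ n!/yⁿ` and `(ρ+1)^q ≤ (2z)^q`
    have hexp : Real.exp (-y) ≤ (Nat.factorial n : ℝ) / y ^ n :=
      Literature.MathematicalPhysics.QuantumLattice.exp_neg_le_factorial_div_pow hy0 n
    have hρz : (ρ : ℝ) + 1 = z + 3 := by rw [hz]; ring
    have hpow : ((ρ : ℝ) + 1) ^ q ≤ (2 * z) ^ q := by
      rw [hρz]; exact pow_le_pow_left₀ (by linarith) (by linarith) q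
    have hA0 : 0 ≤ T₀ + T₁ * ((ρ : ℝ) + 1) ^ q := by positivity
    have hA : T₀ + T₁ * ((ρ : ℝ) + 1) ^ q ≤ (T₀ + T₁ * 2 ^ q) * z ^ q := by
      have h1 : T₁ * ((ρ : ℝ) + 1) ^ q ≤ T₁ * (2 ^ q * z ^ q) := by
        rw [← mul_pow]; exact mul_le_mul_of_nonneg_left hpow hT₁
      have h2 : T₀ ≤ T₀ * z ^ q := le_mul_of_one_le_right hT₀ (one_le_pow₀ (by linarith))
      nlinarith [h1, h2]
    -- `yⁿ = (δ₀/2)ⁿ zⁿ`, so `n!/yⁿ · z^q = n! (2/δ₀)ⁿ / z²`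
    have hyn : y ^ n = (δ₀ / 2) ^ n * z ^ n := by rw [hy, mul_pow]
    have hz2 : z ^ n = z ^ q * z ^ 2 := by rw [hn, pow_add]
    have hzq : 0 < z ^ q := pow_pos hz0 q
    have hδn : 0 < (δ₀ / 2) ^ n := pow_pos (by positivity) n
    have hδ0' : δ₀ ≠ 0 := hδ₀.ne'
    have hz' : z ≠ 0 := hz0.ne'
    have hkey : (T₀ + T₁ * 2 ^ q) * z ^ q * ((Nat.factorial n : ℝ) / y ^ n) = K / z ^ 2 := by
      rw [hyn, hz2, hK]
      simp only [div_pow]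
      field_simp
    calc (T₀ + T₁ * ((ρ : ℝ) + 1) ^ q) * Real.exp (-(δ₀ / 2 * ((ρ : ℝ) - 2)))
        = (T₀ + T₁ * ((ρ : ℝ) + 1) ^ q) * Real.exp (-y) := by rw [hy, hz]
      _ ≤ ((T₀ + T₁ * 2 ^ q) * z ^ q) * ((Nat.factorial n : ℝ) / y ^ n) :=
          mul_le_mul hA hexp (Real.exp_pos _).le (by positivity)
      _ = K / z ^ 2 := hkey
      _ ≤ K / X ^ 2 := div_le_div_of_nonneg_left hK0 (by positivity) (pow_le_pow_left₀ hX0.le hzX 2)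
      _ ≤ 1 / 2 := by
          rw [div_le_iff₀ (by positivity)]
          nlinarith [hXK, hK0]

/-- ★ **(163), POLYNOMIAL PACKAGE CONSTANT — EVENTUAL FORM**: `exists_rho_163_pow`'s inequality holds for EVERY `ρ` above an explicit floor `N ≥ 2` (the proof of
`exists_rho_163_pow` already bounds the left side by `K∕(ρ−2)²` for all `ρ − 2 ≥ max 3 (2K+1)` and instantiates only at the end; this is that proof with the
instantiation removed).  Used by the H door when `ρ` must ALSO satisfy floors and a residue class (LINE «H-P6J», obstacle (O2): [Balaban1985RegularSpaces] Prop. 6's cube datum wants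
`L^{s+1} ∣ ρ′`, `R·L^{s+1} ≤ ρ′`, `ρ₀ ≤ ρ′` for `ρ′ = ρ + M + L + S`). [cite: Balaban1985Variational, (163) p.303; Balaban1985RegularSpaces, Prop. 6 p.99] -/
theorem rho_163_pow_eventually {δ₀ T₀ T₁ : ℝ} (hδ₀ : 0 < δ₀) (hT₀ : 0 ≤ T₀) (hT₁ : 0 ≤ T₁) (q : ℕ) :
    ∃ N : ℕ, 2 ≤ N ∧ ∀ ρ : ℕ, N ≤ ρ → (T₀ + T₁ * ((ρ : ℝ) + 1) ^ q) * Real.exp (-(δ₀ / 2 * ((ρ : ℝ) - 2))) ≤ 1 / 2 := by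
  set n : ℕ := q + 2 with hn
  set K : ℝ := (T₀ + T₁ * 2 ^ q) * (Nat.factorial n : ℝ) * (2 / δ₀) ^ n with hK
  have hK0 : 0 ≤ K := by positivity
  set X : ℝ := max 3 (2 * K + 1) with hX
  have hX3 : (3 : ℝ) ≤ X := le_max_left _ _
  have hXK : 2 * K + 1 ≤ X := le_max_right _ _
  have hX0 : 0 < X := by linarith
  have hceil : 2 + X ≤ ((⌈2 + X⌉₊ : ℕ) : ℝ) := Nat.le_ceil _
  refine ⟨⌈2 + X⌉₊, ?_, fun ρ hρN => ?_⟩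
  · have h : (2 : ℝ) ≤ ((⌈2 + X⌉₊ : ℕ) : ℝ) := by linarith
    exact_mod_cast h
  · have hNρ : ((⌈2 + X⌉₊ : ℕ) : ℝ) ≤ (ρ : ℝ) := by exact_mod_cast hρN
    have hge : 2 + X ≤ (ρ : ℝ) := hceil.trans hNρ
    set z : ℝ := (ρ : ℝ) - 2 with hz
    have hzX : X ≤ z := by rw [hz]; linarith
    have hz3 : 3 ≤ z := hX3.trans hzX
    have hz0 : 0 < z := by linarith
    set y : ℝ := δ₀ / 2 * z with hy
    have hy0 : 0 < y := by positivity
    -- `e^{-y} ≤ n!/yⁿ` and `(ρ+1)^q ≤ (2z)^q`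
    have hexp : Real.exp (-y) ≤ (Nat.factorial n : ℝ) / y ^ n :=
      Literature.MathematicalPhysics.QuantumLattice.exp_neg_le_factorial_div_pow hy0 n
    have hρz : (ρ : ℝ) + 1 = z + 3 := by rw [hz]; ring
    have hpow : ((ρ : ℝ) + 1) ^ q ≤ (2 * z) ^ q := by
      rw [hρz]; exact pow_le_pow_left₀ (by linarith) (by linarith) q
    have hA0 : 0 ≤ T₀ + T₁ * ((ρ : ℝ) + 1) ^ q := by positivity
    have hA : T₀ + T₁ * ((ρ : ℝ) + 1) ^ q ≤ (T₀ + T₁ * 2 ^ q) * z ^ q := by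
      have h1 : T₁ * ((ρ : ℝ) + 1) ^ q ≤ T₁ * (2 ^ q * z ^ q) := by
        rw [← mul_pow]; exact mul_le_mul_of_nonneg_left hpow hT₁
      have h2 : T₀ ≤ T₀ * z ^ q := le_mul_of_one_le_right hT₀ (one_le_pow₀ (by linarith))
      nlinarith [h1, h2]
    -- `yⁿ = (δ₀/2)ⁿ zⁿ`, so `n!/yⁿ · z^q = n! (2/δ₀)ⁿ / z²`
    have hyn : y ^ n = (δ₀ / 2) ^ n * z ^ n := by rw [hy, mul_pow]
    have hz2 : z ^ n = z ^ q * z ^ 2 := by rw [hn, pow_add]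
    have hzq : 0 < z ^ q := pow_pos hz0 q
    have hδn : 0 < (δ₀ / 2) ^ n := pow_pos (by positivity) n
    have hδ0' : δ₀ ≠ 0 := hδ₀.ne'
    have hz' : z ≠ 0 := hz0.ne'
    have hkey : (T₀ + T₁ * 2 ^ q) * z ^ q * ((Nat.factorial n : ℝ) / y ^ n) = K / z ^ 2 := by
      rw [hyn, hz2, hK]
      simp only [div_pow]
      field_simp
    calc (T₀ + T₁ * ((ρ : ℝ) + 1) ^ q) * Real.exp (-(δ₀ / 2 * ((ρ : ℝ) - 2)))
        = (T₀ + T₁ * ((ρ : ℝ) + 1) ^ q) * Real.exp (-y) := by rw [hy, hz]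
      _ ≤ ((T₀ + T₁ * 2 ^ q) * z ^ q) * ((Nat.factorial n : ℝ) / y ^ n) :=
          mul_le_mul hA hexp (Real.exp_pos _).le (by positivity)
      _ = K / z ^ 2 := hkey
      _ ≤ K / X ^ 2 := div_le_div_of_nonneg_left hK0 (by positivity) (pow_le_pow_left₀ hX0.le hzX 2)
      _ ≤ 1 / 2 := by
          rw [div_le_iff₀ (by positivity)]
          nlinarith [hXK, hK0]

/-- ★ **(163), POLYNOMIAL PACKAGE CONSTANT — `ρ` ABOVE A FLOOR AND IN A RESIDUE CLASS**: for every floor `N₀`, modulus `m > 0` and residue `r` there is a `ρ ≥ max 2 N₀`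
with `ρ ≡ r (mod m)` satisfying (163) with the polynomial package constant.  The H door's choice of `ρ` when [Balaban1985RegularSpaces] Prop. 6's cube datum
(`L^{s+1} ∣ ρ + M + L + S`, `R·L^{s+1} ≤ ρ + …`, `ρ₀ ≤ ρ + …`) is imposed (LINE «H-P6J», (O2)); from `rho_163_pow_eventually` by `ρ := r % m + m·max N N₀`.
[cite: Balaban1985Variational, (163) p.303; Balaban1985RegularSpaces, Prop. 6 p.99] -/
theorem exists_rho_163_pow_ge_mod {δ₀ T₀ T₁ : ℝ} (hδ₀ : 0 < δ₀) (hT₀ : 0 ≤ T₀) (hT₁ : 0 ≤ T₁) (q N₀ : ℕ) {m : ℕ} (hm : 0 < m) (r : ℕ) :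
    ∃ ρ : ℕ, N₀ ≤ ρ ∧ (2 : ℝ) ≤ (ρ : ℝ) ∧ ρ % m = r % m ∧
      (T₀ + T₁ * ((ρ : ℝ) + 1) ^ q) * Real.exp (-(δ₀ / 2 * ((ρ : ℝ) - 2))) ≤ 1 / 2 := by
  obtain ⟨N, hN2, hN⟩ := rho_163_pow_eventually hδ₀ hT₀ hT₁ q
  set B : ℕ := max N N₀ with hB
  have hBρ : B ≤ r % m + m * B := by
    have h1 : B ≤ m * B := Nat.le_mul_of_pos_left B hm
    omega
  refine ⟨r % m + m * B, (le_max_right N N₀).trans hBρ, ?_, by rw [Nat.add_mul_mod_self_left, Nat.mod_mod], hN _ ((le_max_left N N₀).trans hBρ)⟩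
  have h : 2 ≤ r % m + m * B := hN2.trans ((le_max_left N N₀).trans hBρ)
  exact_mod_cast h

end Summit.QuantumFields.YangMills.Theorems.HalvingRhoLinearBricks

end
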